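import Summits.Ventures.HodgeRepro2.T6A1HypHost

/-!
# T6A1HostExistence — the Shimura-Theorem-3 path to the non-vacuity of `Host.CornerProduct`, made explicit
(README §10.5(ii)(c): «check no hypothesis quantifies over an empty / uninstantiable carrier (exhibit an
instance or cite where print guarantees nonemptiness)»; owner t6-p1)

The final theorem quantifies over `C : Host.CornerProduct K` (inside `Hyp.Given_S4`). The host carriers carry
no product of schemes, so a KERNEL instance of `CornerProduct` is not available from this cell; what print
guarantees is made explicit here in kernel, consuming the display BY NAME:
* `exists_factors` / `exists_factors_dim_three` — the display `Hyp.Shimura1998_Thm3 K` (existence of a CM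
  abelian variety of every CM type, `T6A1HypHost`) gives, for every face `F`, four CM abelian threefolds of
  the face's types `F.T i` (the face's types are CM types: `F.face.1`; `dim = [K : ℚ] / 2 = 3` by `F.deg6`);
* `nonempty_cornerProduct_of_thm3` — THE REDUCTION: the non-vacuity of `CornerProduct K` over `F` follows from
  that display and ONE residual, the PRODUCT CONSTRUCTION `hprod` (four CM threefolds of the face's types have
  a corner product `B = A₁ × A₂ × A₃ × A₄` with its projections, the diagonal order action and the Künneth
  splitting of `H¹`; Lange–Birkenhake §1.1 / Shimura 1998 §5 — a host-side construction the package does not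
  carry), stated as an explicit hypothesis of the theorem, NOT as a display;
* `thm3_conclusion_of_cornerProduct` — the converse consistency check: any corner product witnesses the
  conclusion of Theorem 3 at its four vertices.
No new display, no definition, no axiom. §8(d): uses an L-value-free non-vanishing device: NO.
-/

noncomputable section

open HostAPI.Carriers.AlgebraicGeometry.Motives HostAPI.Carriers.AlgebraicGeometry.HodgeTheory

namespace Summit.Ventures.HodgeRepro2.T6.A1HostExistence

open Host

variable {K : Type} [Field K] [NumberField K] [NumberField.IsCMField K]

/-- The Shimura-Theorem-3 path, factor side: the display gives four CM abelian varieties of the face's types,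
each of dimension `[K : ℚ] / 2`. -/
theorem exists_factors (h : Hyp.Shimura1998_Thm3 K) (F : FaceSetting K) :
    ∃ A : Fin 4 → CMVariety K, ∀ i, (A i).type = F.T i ∧ Module.finrank ℚ K = 2 * (A i).A.dim := by
  choose A hA using fun i => h (F.T i) (F.face.1 i)
  exact ⟨A, hA⟩

/-- The same with the dimension clause of `CornerProduct.dim_factor`: the factors are threefolds
(`[K : ℚ] = 6`, `F.deg6`). -/
theorem exists_factors_dim_three (h : Hyp.Shimura1998_Thm3 K) (F : FaceSetting K) :
    ∃ A : Fin 4 → CMVariety K, ∀ i, (A i).type = F.T i ∧ (A i).A.dim = 3 := by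
  obtain ⟨A, hA⟩ := exists_factors h F
  refine ⟨A, fun i => ⟨(hA i).1, ?_⟩⟩
  have h2 := (hA i).2
  rw [F.deg6] at h2
  omega

/-- THE REDUCTION of the non-vacuity of `CornerProduct K` over a face `F` to the display Shimura Thm 3 and the
product construction `hprod` (the residual, an explicit hypothesis: four CM threefolds of the face's types have a
corner product with those factors and that face). -/
theorem nonempty_cornerProduct_of_thm3 (h : Hyp.Shimura1998_Thm3 K) (F : FaceSetting K)
    (hprod : ∀ A : Fin 4 → CMVariety K, (∀ i, (A i).type = F.T i) → (∀ i, (A i).A.dim = 3) →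
      ∃ C : CornerProduct K, C.F = F ∧ C.A = A) :
    ∃ C : CornerProduct K, C.F = F := by
  obtain ⟨A, hA⟩ := exists_factors_dim_three h F
  obtain ⟨C, hCF, -⟩ := hprod A (fun i => (hA i).1) (fun i => (hA i).2)
  exact ⟨C, hCF⟩

/-- Consistency (the converse direction): every corner product witnesses the conclusion of Shimura's Theorem 3
at each of the four vertices of its face — its factors are CM abelian varieties of the vertex types, of
dimension `[K : ℚ] / 2`. -/
theorem thm3_conclusion_of_cornerProduct (C : CornerProduct K) (i : Fin 4) :
    ∃ A : CMVariety K, A.type = C.F.T i ∧ Module.finrank ℚ K = 2 * A.A.dim :=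
  ⟨C.A i, C.type_factor i, by rw [C.F.deg6, C.dim_factor i]⟩

/-- The carrier `CMVariety K` is inhabited under the display, for every CM type. -/
theorem nonempty_cmVariety (h : Hyp.Shimura1998_Thm3 K) (Φ : Set (K →+* ℂ))
    (hΦ : Summit.Ventures.HodgeRepro2.IsCMType K Φ) : Nonempty (CMVariety K) :=
  let ⟨C, _⟩ := h Φ hΦ
  ⟨C⟩

end Summit.Ventures.HodgeRepro2.T6.A1HostExistence

end
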